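import Summits.ResolutionOfSingularities.ResolutionOfSingularities.Theorems.DescentDescentPerfectToAllPerfectCore
import Summits.ResolutionOfSingularities.ResolutionOfSingularities.Theorems.DescentDescentPerfectToAllResidualWitnessRank
import Summits.ResolutionOfSingularities.ResolutionOfSingularities.Theorems.DescentDescentPerfectToAllPIndependence
import Literature.AlgebraicGeometry.Resolution.PIndependence
import HarnessLib

/-!
# `DescentPerfectToAll` (stmt-ResolutionOfSingularities-0549): the DICHOTOMY AT THE PERFECT CORE — among
# fields of finite transcendence degree `n` over their perfect core, the EFT-separably exhausted ones are
# exactly those of `p`-rank `n`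

Route `ResolutionOfSingularities/Descent`, crux `DescentPerfectToAll`. Helper (OURS; not a statement of any
manuscript; `--supports` the crux, does not close it).

`descentPerfectToAll_iff_residual` (`DescentDescentPerfectToAllExhaustion.lean`) says the crux is equivalent to:
resolution over perfect fields of characteristic `p` gives resolution over the countable fields of characteristic
`p` that are NOT EFT-separably exhausted. This file computes that class exactly on fields of finite transcendence
degree over their PERFECT CORE `P` (the largest perfect subfield, `P = ⋂ₙ K^{pⁿ}`; it contains the image of
every perfect field):

* `exists_perfectCore` — every field of characteristic `p` has a perfect core.
* `not_exhaustedByEssFiniteType_of_pRank_le_of_perfectCore` — **residual criterion with a perfect core**: if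
  every `K^p`-linearly independent finite family has at most `p^r` members and `K` contains `r + 1` elements
  algebraically independent over a subfield `P` containing all images of perfect fields, then `K` is NOT
  EFT-separably exhausted (generalises `not_exhaustedByEssFiniteType_of_pRank_le`, the case `P = 𝔽_p`; same
  proof: `[E : E^p] = p^{tr.deg_{k₀} E} ≥ p^{r+1}` for the relevant level `E`, and Mac Lane symmetry).
* `pIndependent_of_isPIndependent` — dictionary: a finite injective family that is `p`-independent over `K^p`
  in the sense of `Literature.AlgebraicGeometry.Resolution.IsPIndependent` (degrees `[K^p(t) : K^p] = p^{#t}`)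
  is `p`-independent in the monomial sense of these files (chain criterion `pIndependent_of_chain`).
* `exists_pIndependent_or_pRank_le` — for every `n`: either `K` has `n` `p`-independent elements, or every
  `K^p`-linearly independent finite family has at most `p^{n-1}` members (a `p`-basis of `K / K^p`,
  `exists_isPIndependent_adjoin_eq_top`, has `≥ n` or `< n` elements).
* `exhaustedByEssFiniteType_iff_exists_pIndependent_of_perfectCore` — **THE DICHOTOMY.** For `K` with perfect
  core `P` and a transcendence basis `x₁, …, xₙ` of `K / P`: `K` is EFT-separably exhausted **iff** `K` has `n`
  `p`-independent elements (`⇐`: `exhaustedByEssFiniteType_of_pIndependent_of_trdeg_le`; `⇒`: otherwise the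
  `p`-rank is `≤ p^{n-1}` and the residual criterion applies).
* `not_exhaustedByEssFiniteType_iff_pRank_le_of_perfectCore` — equivalently (`n ≥ 1`): NOT exhausted iff every
  `K^p`-free finite family has `≤ p^{n-1}` members (`p`-rank `< n`).
* `hasResolution_of_perfectRes_of_perfectCore` — so, given `PerfectRes p`, resolution holds over every such
  `K` with `n` `p`-independent elements; what the crux still asks, in finite transcendence degree over the
  perfect core, is exactly the `p`-rank-deficient fields (kernel inhabitants: the `𝔽_p(t, u)`-hulls in
  `𝔽_p((t))` of `exists_countable_field_not_exhaustedByEssFiniteType`).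

[cite: Matsumura1987, Thm. 26.5 and Thm. 26.8; EGAIV2, Prop. 6.7.4] [folklore]
-/

noncomputable section

set_option linter.dupNamespace false -- mandated namespace of this single-conjunct summit

open CategoryTheory CategoryTheory.Limits AlgebraicGeometry
open Literature.AlgebraicGeometry.Resolution

namespace Summit.ResolutionOfSingularities.ResolutionOfSingularities.Theorems

variable {p : ℕ} [Fact p.Prime] {K : Type} [Field K] [CharP K p]

/-! ## The perfect core -/

variable (p K) in
/-- **The perfect core.** Every field `K` of characteristic `p` has a perfect subfield `P` (every element of `P`
is a `p`-th power of an element of `P`) containing the image of every ring map from a perfect field into `K`;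
namely `P = ⋂ₙ K^{pⁿ}`. [folklore] -/
theorem exists_perfectCore :
    ∃ P : Subfield K, (∀ x ∈ P, ∃ y ∈ P, y ^ p = x) ∧
      ∀ (k₀ : Type) [Field k₀] [PerfectField k₀] (φ : k₀ →+* K) (a : k₀), φ a ∈ P := by
  have hp : p.Prime := Fact.out
  haveI : ExpChar K p := ExpChar.prime hp
  refine ⟨⨅ n : ℕ, (iterateFrobenius K p n).fieldRange, fun x hx => ?_, fun k₀ _ _ φ a => ?_⟩
  · rw [Subfield.mem_iInf] at hx
    obtain ⟨y, hy⟩ := RingHom.mem_fieldRange.mp (hx 1)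
    rw [iterateFrobenius_def, pow_one] at hy
    refine ⟨y, Subfield.mem_iInf.mpr fun n => ?_, hy⟩
    obtain ⟨z, hz⟩ := RingHom.mem_fieldRange.mp (hx (n + 1))
    refine RingHom.mem_fieldRange.mpr ⟨z, frobenius_inj K p ?_⟩
    rw [frobenius_def, frobenius_def, iterateFrobenius_def, ← pow_mul, ← pow_succ, hy, ← hz,
      iterateFrobenius_def]
  · haveI : CharP k₀ p := φ.charP φ.injective p
    haveI : ExpChar k₀ p := ExpChar.prime hp
    haveI : PerfectRing k₀ p := PerfectField.toPerfectRing p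
    rw [Subfield.mem_iInf]
    intro n
    refine RingHom.mem_fieldRange.mpr ⟨φ ((iterateFrobeniusEquiv k₀ p n).symm a), ?_⟩
    rw [iterateFrobenius_def, ← map_pow, ← iterateFrobenius_def, ← iterateFrobeniusEquiv_apply,
      RingEquiv.apply_symm_apply]

/-! ## The residual criterion with a perfect core -/

variable (p) in
/-- **`p`-rank defect relative to the perfect core ⇒ not EFT-separably exhausted.** Let `K` have characteristic
`p` and suppose: (a) every finite `K^p`-linearly independent family in `K` has at most `p^r` members; (b) `P ≤ K`
is a subfield containing the image of every ring map from a perfect field (e.g. the perfect core); (c) `K`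
contains a family of at least `r + 1` elements algebraically independent over `P`. Then `K` is not EFT-separably
exhausted: for a perfect `k₀` and a level `E ≤ K` essentially of finite type over `k₀` containing the family,
the image of `k₀` lies in `P`, so the family stays algebraically independent over `k₀`
(`AlgebraicIndependent.restrictScalars`) and `[E : E^p] = p^{tr.deg_{k₀} E} ≥ p^{r+1}` (Matsumura Thm. 26.5,
tree `exists_finrank_frobenius_eq_pow_card`); Mac Lane symmetry (`linearIndependent_frobenius_of_macLane`) moves
an `E^p`-basis of `E` to a `K^p`-linearly independent family with more than `p^r` members.
[cite: Matsumura1987, Thm. 26.5; EGAIV2, Prop. 6.7.4] -/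
theorem not_exhaustedByEssFiniteType_of_pRank_le_of_perfectCore (r : ℕ)
    (hrank : ∀ (n : ℕ) (v : Fin n → K), LinearIndependent (frobenius K p).fieldRange v → n ≤ p ^ r)
    (P : Subfield K)
    (hcore : ∀ (k₀ : Type) [Field k₀] [PerfectField k₀] (φ : k₀ →+* K) (a : k₀), φ a ∈ P)
    {ι : Type} [Fintype ι] (x : ι → K) (hx : AlgebraicIndependent P x) (hr : r + 1 ≤ Fintype.card ι) :
    ¬ ∀ s : Finset K, ∃ (k₀ : Type) (_ : Field k₀) (_ : PerfectField k₀)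
      (E : Subfield K) (_ : Algebra k₀ E), Algebra.EssFiniteType k₀ E ∧ (↑s : Set K) ⊆ E ∧
        ∀ u : Finset K, LinearIndepOn E _root_.id (↑u : Set K) →
          LinearIndepOn E (fun y : K => y ^ p) (↑u : Set K) := by
  classical
  intro hk
  have hp : p.Prime := Fact.out
  obtain ⟨k₀, hF, hP, E, hA, hEFT, hsub, hML⟩ := hk (Finset.univ.image x)
  haveI : CharP E p := E.subtype.charP Subtype.val_injective p
  have hxE : ∀ i, x i ∈ E := fun i => hsub (by simp)
  -- the image of `k₀` lies in `P`
  set φ : k₀ →+* K := E.subtype.comp (algebraMap k₀ E) with hφ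
  have hφP : ∀ a, φ a ∈ P := fun a => hcore k₀ φ a
  let φP : k₀ →+* P := φ.codRestrict P hφP
  letI : Algebra k₀ K := φ.toAlgebra
  letI : Algebra k₀ P := φP.toAlgebra
  haveI : IsScalarTower k₀ P K := IsScalarTower.of_algebraMap_eq fun _ => rfl
  haveI : IsScalarTower k₀ E K := IsScalarTower.of_algebraMap_eq fun _ => rfl
  -- `x` is algebraically independent over `k₀`, in `K` and then in `E`
  have hxk : AlgebraicIndependent k₀ x := hx.restrictScalars φP.injective
  set xE : ι → E := fun i => ⟨x i, hxE i⟩ with hxEdef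
  have hindE : AlgebraicIndependent k₀ xE :=
    AlgebraicIndependent.of_comp (IsScalarTower.toAlgHom k₀ E K)
      (by rwa [show (⇑(IsScalarTower.toAlgHom k₀ E K) ∘ xE) = x from funext fun _ => rfl])
  -- `[E : E^p] = p ^ #t` for a transcendence basis `t` of `E/k₀`, and `#t ≥ r + 1`
  obtain ⟨t, ht, -, -, hfin⟩ :=
    Literature.FieldTheory.Separability.exists_finrank_frobenius_eq_pow_card (k := k₀) (K := E) p
  have hrt : r + 1 ≤ t.card := by
    have h1 := hindE.cardinalMk_le_trdeg
    rw [← ht.cardinalMk_eq_trdeg, Cardinal.mk_coe_finset, Cardinal.mk_fintype] at h1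
    norm_cast at h1
    exact hr.trans h1
  -- an `E^p`-basis of `E`, moved into `K` by Mac Lane symmetry, has `p ^ #t ≤ p ^ r` members
  haveI : Module.Finite (frobenius E p).fieldRange E :=
    Module.finite_of_finrank_pos (by rw [hfin]; exact pow_pos hp.pos _)
  let b := Module.finBasis (frobenius E p).fieldRange E
  have hbK := linearIndependent_frobenius_of_macLane p E hML b b.linearIndependent
  have hcard := hrank _ _ hbK
  rw [hfin] at hcard
  have h3 : p ^ (r + 1) ≤ p ^ t.card := Nat.pow_le_pow_right hp.pos hrt
  have h4 : p ^ r < p ^ (r + 1) := Nat.pow_lt_pow_right hp.one_lt (Nat.lt_succ_self r)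
  exact absurd (h3.trans hcard) (not_le.mpr h4)

/-! ## `p`-independent families versus the `p`-rank -/

variable (p) in
/-- **Dictionary**: an injective finite family `t` whose range is `p`-independent over `K^p` in the sense of
`Literature.AlgebraicGeometry.Resolution.IsPIndependent` (`[K^p(s) : K^p] = p^{#s}` for finite `s ⊆ range t`) is
`p`-independent in the monomial sense (`∑_α t^α e_α^p = 0 ⇒ e = 0`): by the chain criterion
`pIndependent_of_chain`, since `t_j ∈ K^p(t_{<j})` would give `K^p(t_{≤j}) = K^p(t_{<j})`, of degrees
`p^{j+1} ≠ p^j`. [folklore] -/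
theorem pIndependent_of_isPIndependent {n : ℕ} (t : Fin n → K) (hinj : Function.Injective t)
    (ht : IsPIndependent (F := (frobenius K p).fieldRange) p (Set.range t)) :
    ∀ e : (Fin n → Fin p) → K, ∑ α, (∏ i, t i ^ (α i : ℕ)) * e α ^ p = 0 → ∀ α, e α = 0 := by
  classical
  have hp : p.Prime := Fact.out
  set Kp := (frobenius K p).fieldRange with hKp
  refine pIndependent_of_chain t fun j hmem => ?_
  -- `closure (range (·^p) ∪ t '' {i<j}) = K^p(t_{<j})`
  have hrange : Set.range (fun x : K => x ^ p) = Set.range (algebraMap Kp K) := by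
    ext y
    constructor
    · rintro ⟨x, rfl⟩
      exact ⟨⟨x ^ p, RingHom.mem_fieldRange.mpr ⟨x, frobenius_def ..⟩⟩, rfl⟩
    · rintro ⟨z, rfl⟩
      obtain ⟨x, hx⟩ := RingHom.mem_fieldRange.mp z.2
      refine ⟨x, ?_⟩
      show x ^ p = (z : K)
      rw [← hx, frobenius_def]
  have hj : t j ∈ IntermediateField.adjoin Kp (t '' {i : Fin n | i < j}) := by
    rw [← IntermediateField.mem_toSubfield, IntermediateField.adjoin_toSubfield, ← hrange]
    exact hmem
  -- the finsets `A = t '' {i<j}` and `insert (t j) A`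
  set A : Finset K := (Finset.univ.filter (fun i : Fin n => i < j)).image t with hAdef
  have hAcoe : (↑A : Set K) = t '' {i : Fin n | i < j} := by
    rw [hAdef, Finset.coe_image, Finset.coe_filter]
    simp only [Finset.mem_univ, true_and]
  have hAsub : (↑A : Set K) ⊆ Set.range t := by
    rw [hAcoe]
    exact Set.image_subset_range _ _
  have hBsub : (↑(insert (t j) A) : Set K) ⊆ Set.range t := by
    rw [Finset.coe_insert]
    exact Set.insert_subset ⟨j, rfl⟩ hAsub
  have hnot : t j ∉ A := by
    rw [hAdef, Finset.mem_image]
    rintro ⟨i, hi, hij⟩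
    rw [Finset.mem_filter] at hi
    exact (lt_irrefl j) (hinj hij ▸ hi.2)
  have hA := ht A hAsub
  have hB := ht (insert (t j) A) hBsub
  rw [Finset.card_insert_of_notMem hnot] at hB
  -- but `K^p(t_{≤j}) = K^p(t_{<j})`
  have heq : IntermediateField.adjoin Kp (↑(insert (t j) A) : Set K) =
      IntermediateField.adjoin Kp (↑A : Set K) := by
    rw [Finset.coe_insert]
    apply le_antisymm
    · rw [IntermediateField.adjoin_le_iff, Set.insert_subset_iff]
      exact ⟨by rw [hAcoe]; exact hj, IntermediateField.subset_adjoin _ _⟩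
    · exact IntermediateField.adjoin.mono _ _ _ (Set.subset_insert _ _)
  rw [heq, hA, pow_succ] at hB
  have h1 : p ^ A.card * 1 = p ^ A.card * p := by rw [mul_one]; exact hB
  have h2 := Nat.eq_of_mul_eq_mul_left (pow_pos hp.pos _) h1
  exact hp.one_lt.ne h2

variable (p) in
/-- **`n` `p`-independent elements, or `p`-rank `≤ p^{n-1}`.** For every field `K` of characteristic `p` and
every `n`: either `K` contains a `p`-independent family of `n` elements, or every finite `K^p`-linearly
independent family in `K` has at most `p^{n-1}` members. (Take a `p`-basis `Γ` of `K / K^p`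
(`exists_isPIndependent_adjoin_eq_top`): if `Γ` has `n` elements they are `p`-independent; otherwise `Γ` is
finite with `#Γ ≤ n - 1` and `[K : K^p] = p^{#Γ}`.) [cite: Matsumura1987, §26 p. 202] -/
theorem exists_pIndependent_or_pRank_le (n : ℕ) :
    (∃ t : Fin n → K, ∀ e : (Fin n → Fin p) → K,
        ∑ α, (∏ i, t i ^ (α i : ℕ)) * e α ^ p = 0 → ∀ α, e α = 0) ∨
      ∀ (m : ℕ) (v : Fin m → K), LinearIndependent (frobenius K p).fieldRange v → m ≤ p ^ (n - 1) := by
  classical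
  have hp : p.Prime := Fact.out
  set Kp := (frobenius K p).fieldRange with hKp
  have hexp : ∀ x : K, x ^ p ∈ (algebraMap Kp K).range := fun x =>
    ⟨⟨x ^ p, RingHom.mem_fieldRange.mpr ⟨x, frobenius_def ..⟩⟩, rfl⟩
  obtain ⟨Γ, hΓ, hΓtop⟩ := exists_isPIndependent_adjoin_eq_top Kp p hexp
  -- an injective family of `n` elements of `Γ` is `p`-independent
  have hleft : ∀ t : Fin n → K, Function.Injective t → Set.range t ⊆ Γ →
      ∀ e : (Fin n → Fin p) → K, ∑ α, (∏ i, t i ^ (α i : ℕ)) * e α ^ p = 0 → ∀ α, e α = 0 :=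
    fun t hinj hsub => pIndependent_of_isPIndependent p t hinj (hΓ.mono hsub)
  by_cases hfin : Γ.Finite
  · set s := hfin.toFinset with hs
    have hscoe : (↑s : Set K) = Γ := hfin.coe_toFinset
    by_cases hcard : n ≤ s.card
    · -- `n` elements of `Γ`
      left
      obtain ⟨emb⟩ := Function.Embedding.nonempty_iff_card_le.mpr
        (show Fintype.card (Fin n) ≤ Fintype.card ↥s by rw [Fintype.card_fin, Fintype.card_coe]; exact hcard)
      refine ⟨fun i => (emb i : K), hleft _ (fun a b h => emb.injective (Subtype.ext h)) ?_⟩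
      rintro _ ⟨i, rfl⟩
      rw [← hscoe]
      exact (emb i).2
    · -- `[K : K^p] = p ^ #Γ ≤ p ^ (n - 1)`
      right
      intro m v hv
      have hsn : s.card ≤ n - 1 := by omega
      have hdeg : Module.finrank Kp (IntermediateField.adjoin Kp (↑s : Set K)) = p ^ s.card :=
        hΓ s hscoe.le
      rw [hscoe, hΓtop, IntermediateField.finrank_top'] at hdeg
      haveI : Module.Finite Kp K := Module.finite_of_finrank_pos (by rw [hdeg]; exact pow_pos hp.pos _)
      have h := hv.fintype_card_le_finrank
      rw [Fintype.card_fin, hdeg] at h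
      exact h.trans (Nat.pow_le_pow_right hp.pos hsn)
  · -- `Γ` infinite: `n` elements of `Γ`
    left
    let emb := Set.Infinite.natEmbedding Γ hfin
    refine ⟨fun i : Fin n => (emb i : K), hleft _ (fun a b h => ?_) ?_⟩
    · exact Fin.ext (emb.injective (Subtype.ext h))
    · rintro _ ⟨i, rfl⟩
      exact (emb i).2

/-! ## The dichotomy at the perfect core -/

variable (p) in
/-- **THE DICHOTOMY AT THE PERFECT CORE.** Let `K` have characteristic `p`, let `P ≤ K` be perfect and contain the
image of every ring map from a perfect field (the perfect core), and let `x₁, …, xₙ` be a transcendence basis of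
`K / P`. Then `K` is EFT-separably exhausted (the hypothesis of the master class
`hasResolution_of_perfectRes_of_exhaustedByEssFiniteType`) **if and only if** `K` contains `n` `p`-independent
elements (`p`-rank `= n`): `⇐` is `exhaustedByEssFiniteType_of_pIndependent_of_trdeg_le`; for `⇒`, if there
is no such family then every `K^p`-free finite family has `≤ p^{n-1}` members
(`exists_pIndependent_or_pRank_le`) and `not_exhaustedByEssFiniteType_of_pRank_le_of_perfectCore` applies with
the `n` algebraically independent `xᵢ`. [cite: Matsumura1987, Thm. 26.5 and Thm. 26.8] -/
theorem exhaustedByEssFiniteType_iff_exists_pIndependent_of_perfectCore (P : Subfield K)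
    (hP : ∀ x ∈ P, ∃ y ∈ P, y ^ p = x)
    (hcore : ∀ (k₀ : Type) [Field k₀] [PerfectField k₀] (φ : k₀ →+* K) (a : k₀), φ a ∈ P)
    {n : ℕ} (x : Fin n → K) (hx : IsTranscendenceBasis P x) :
    (∀ s : Finset K, ∃ (k₀ : Type) (_ : Field k₀) (_ : PerfectField k₀)
      (E : Subfield K) (_ : Algebra k₀ E), Algebra.EssFiniteType k₀ E ∧ (↑s : Set K) ⊆ E ∧
        ∀ u : Finset K, LinearIndepOn E _root_.id (↑u : Set K) →
          LinearIndepOn E (fun y : K => y ^ p) (↑u : Set K)) ↔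
    ∃ t : Fin n → K, ∀ e : (Fin n → Fin p) → K,
        ∑ α, (∏ i, t i ^ (α i : ℕ)) * e α ^ p = 0 → ∀ α, e α = 0 := by
  classical
  have htr : Algebra.trdeg P K = n := by
    rw [← hx.cardinalMk_eq_trdeg, Cardinal.mk_fintype, Fintype.card_fin]
  constructor
  · intro hk
    rcases exists_pIndependent_or_pRank_le p (K := K) n with h | h
    · exact h
    · rcases Nat.eq_zero_or_pos n with hn | hn
      · subst hn
        exact ⟨Fin.elim0, pIndependent_of_chain _ fun j => Fin.elim0 j⟩
      · exfalso
        refine not_exhaustedByEssFiniteType_of_pRank_le_of_perfectCore p (n - 1) h P hcore x hx.1 ?_ hk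
        rw [Fintype.card_fin]
        omega
  · rintro ⟨t, ht⟩
    exact exhaustedByEssFiniteType_of_pIndependent_of_trdeg_le P hP t ht htr.le

variable (p) in
/-- **The residual class at the perfect core = `p`-rank-deficient fields.** With `P` the perfect core and
`x₁, …, xₙ` (`n ≥ 1`) a transcendence basis of `K / P`: `K` is NOT EFT-separably exhausted iff every
`K^p`-linearly independent finite family has at most `p^{n-1}` members (`p`-rank `< n`; it is always `≤ n`,
`card_le_pow_of_linearIndependent_frobenius`). [cite: Matsumura1987, Thm. 26.5 and Thm. 26.8] -/
theorem not_exhaustedByEssFiniteType_iff_pRank_le_of_perfectCore (P : Subfield K)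
    (hP : ∀ x ∈ P, ∃ y ∈ P, y ^ p = x)
    (hcore : ∀ (k₀ : Type) [Field k₀] [PerfectField k₀] (φ : k₀ →+* K) (a : k₀), φ a ∈ P)
    {n : ℕ} (hn : 1 ≤ n) (x : Fin n → K) (hx : IsTranscendenceBasis P x) :
    (¬ ∀ s : Finset K, ∃ (k₀ : Type) (_ : Field k₀) (_ : PerfectField k₀)
      (E : Subfield K) (_ : Algebra k₀ E), Algebra.EssFiniteType k₀ E ∧ (↑s : Set K) ⊆ E ∧
        ∀ u : Finset K, LinearIndepOn E _root_.id (↑u : Set K) →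
          LinearIndepOn E (fun y : K => y ^ p) (↑u : Set K)) ↔
    ∀ (m : ℕ) (v : Fin m → K), LinearIndependent (frobenius K p).fieldRange v → m ≤ p ^ (n - 1) := by
  classical
  have hp : p.Prime := Fact.out
  rw [exhaustedByEssFiniteType_iff_exists_pIndependent_of_perfectCore p P hP hcore x hx]
  constructor
  · intro hno
    rcases exists_pIndependent_or_pRank_le p (K := K) n with h | h
    · exact absurd h hno
    · exact h
  · rintro h ⟨t, ht⟩
    -- `n` `p`-independent elements give `p^n` independent monomials
    have hli := linearIndependent_frobenius_monomials t ht
    have hcard := h _ _ (hli.comp _ (Fintype.equivFin (Fin n → Fin p)).symm.injective)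
    rw [Fintype.card_fun, Fintype.card_fin, Fintype.card_fin] at hcard
    have hlt : p ^ (n - 1) < p ^ n := Nat.pow_lt_pow_right hp.one_lt (by omega)
    exact absurd hcard (not_le.mpr hlt)

/-- **Given `PerfectRes p`: resolution over every field with perfect core `P`, transcendence basis `x₁, …, xₙ`
over `P`, and `n` `p`-independent elements** — the positive half of the dichotomy, for reduced separated schemes
of finite type of any dimension; the negative half (`p`-rank `< n`) is where the crux `DescentPerfectToAll`
remains open. [folklore] -/
theorem hasResolution_of_perfectRes_of_perfectCore (p : ℕ) [Fact p.Prime]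
    (H : ∀ (κ : Type) [Field κ] [CharP κ p] [PerfectField κ] (Z : Scheme.{0}) (h : Z ⟶ Spec (.of κ)),
      IsSeparated h → LocallyOfFiniteType h → QuasiCompact h → IsReduced Z → Scheme.HasResolution Z)
    (K : Type) [Field K] [CharP K p] (P : Subfield K) (hP : ∀ x ∈ P, ∃ y ∈ P, y ^ p = x)
    {n : ℕ} (x : Fin n → K) (hx : IsTranscendenceBasis P x) (t : Fin n → K)
    (ht : ∀ e : (Fin n → Fin p) → K, ∑ α, (∏ i, t i ^ (α i : ℕ)) * e α ^ p = 0 → ∀ α, e α = 0)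
    (X : Scheme.{0}) (f : X ⟶ Spec (.of K)) [IsSeparated f] [LocallyOfFiniteType f] [QuasiCompact f]
    [IsReduced X] : Scheme.HasResolution X := by
  have htr : Algebra.trdeg P K = n := by
    rw [← hx.cardinalMk_eq_trdeg, Cardinal.mk_fintype, Fintype.card_fin]
  exact hasResolution_of_perfectRes_of_pIndependent_of_trdeg_le p H K P hP t ht htr.le X f

end Summit.ResolutionOfSingularities.ResolutionOfSingularities.Theorems

end
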